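import Summits.AtomisticToContinuum.FouriersLaw.Theorems.IncoherentChannel.Negative.HarmonicWick
import Literature.Barriers.AtomisticToContinuum.HarmonicCrystalBallisticProofs
import Literature.Barriers.AtomisticToContinuum.FixedLengthNoConductivityControl

/-!
# IncoherentBounded — calibration at the harmonic corner: the item holds there with `B = 0`

Helper for item `stmt-AtomisticToContinuum-11815` (`PhononMeanFreePath.IncoherentBounded`, support):
`∀ params > 0, ∀ T > 0, ∃ B, ∀ N, |a_N| ≤ B`, `a_N := N (γ²/T²) ∫₀^∞ (C_N − 2 r_N²)`.

At the integrable corner `lam = β = 0` (pinned HARMONIC chain, `ω₂ > 0`, `γ ≥ 0`, `T > 0`) the proved Wick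
identity `C_N(t) = 2 r_N(t)²` (`IncoherentChannel.Negative.HarmonicWick.harmonic_wick`) makes the item's
integrand vanish identically, so `a_N = 0` for every `N` and the conclusion of `IncoherentBounded` holds with
`B = 0` (`incoherentBounded_conclusion_harmonic`), whereas the bounded-response waypoint FAILS there
(`HarmonicChainBallisticFlux.not_hasBoundedResponse`): `harmonic_corner_separates`. Consequences recorded for
the planner / refuter: (i) unlike crux `IncoherentChannel` (`crux_false_without_anharmonicity`) and unlike
`BoundedResponse`, the item is NOT refuted by relaxing `0 < lam, 0 < β` to `0 ≤ lam, 0 ≤ β` at the corner —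
the harmonic barrier `HarmonicChainBallisticFlux` does not bite on it; (ii) `IncoherentBounded` does not imply
`BoundedResponse` without a bound on the coherent channel (cf. `boundedResponse_iff_coherentBounded_of_incoherentBounded`):
the whole ballistic divergence `N·G_N → ∞` of the harmonic chain sits in the coherent channel.
-/

noncomputable section

open MeasureTheory Filter Topology Set
open scoped NNReal
open Literature.MathematicalPhysics.KineticTheory.HeatConduction
open Literature.Barriers.AtomisticToContinuum
open Summit.AtomisticToContinuum.FouriersLaw.Theorems.IncoherentChannel.Negative.HarmonicWick

namespace Summit.AtomisticToContinuum.FouriersLaw.Theorems.IncoherentBounded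

section Harmonic

variable {ω₂ γ : ℝ} (hω : 0 < ω₂) (hγ : 0 ≤ γ) {T : ℝ} (hT : 0 < T)
include hω hγ hT

/-- At the harmonic corner the item's integrand `C_N(t) − 2 r_N(t)²` vanishes for every `N` and `t`
(Wick). [cite: RiederLebowitzLieb1967] -/
theorem harmonic_incoherentIntegrand_eq_zero (N : ℕ) (t : ℝ) :
    ((∫ z, (z.2 0) ^ 2 * (∫ y, (y.2 (Fin.last N)) ^ 2 ∂((pinnedChain ω₂ 0 0 γ).transitionKernel (N + 1) T T t.toNNReal z)) ∂((pinnedChain ω₂ 0 0 γ).gibbsMeasure (N + 1) T)) - (∫ z, (z.2 0) ^ 2 ∂((pinnedChain ω₂ 0 0 γ).gibbsMeasure (N + 1) T)) * (∫ z, (∫ y, (y.2 (Fin.last N)) ^ 2 ∂((pinnedChain ω₂ 0 0 γ).transitionKernel (N + 1) T T t.toNNReal z)) ∂((pinnedChain ω₂ 0 0 γ).gibbsMeasure (N + 1) T)) - 2 * (∫ z, z.2 0 * (∫ y, y.2 (Fin.last N) ∂((pinnedChain ω₂ 0 0 γ).transitionKernel (N + 1) T T t.toNNReal z)) ∂((pinnedChain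 ω₂ 0 0 γ).gibbsMeasure (N + 1) T)) ^ 2) = 0 := by
  rw [sub_eq_zero]
  exact harmonic_wick hω hγ hT N t

/-- Hence `a_N = N (γ²/T²) ∫₀^∞ (C_N − 2 r_N²) = 0` for every `N` at the harmonic corner. [folklore] -/
theorem harmonic_incoherentSeq_eq_zero (N : ℕ) :
    (N : ℝ) * (γ ^ 2 / T ^ 2) * ∫ t in Set.Ioi (0 : ℝ), ((∫ z, (z.2 0) ^ 2 * (∫ y, (y.2 (Fin.last N)) ^ 2 ∂((pinnedChain ω₂ 0 0 γ).transitionKernel (N + 1) T T t.toNNReal z)) ∂((pinnedChain ω₂ 0 0 γ).gibbsMeasure (N + 1) T)) - (∫ z, (z.2 0) ^ 2 ∂((pinnedChain ω₂ 0 0 γ).gibbsMeasure (N + 1) T)) * (∫ z, (∫ y, (y.2 (Fin.last N)) ^ 2 ∂((pinnedChain ω₂ 0 0 γ).transitionKernel (N + 1) T T t.toNNReal z)) ∂((pinnedChain ω₂ 0 0 γ).gibbsMeasure (N + 1) T)) - 2 * (∫ z, z.2 0 * (∫ y, y.2 (Fin.last N) ∂((pinnedChain ω₂ 0 0 γ).transitionKernel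 (N + 1) T T t.toNNReal z)) ∂((pinnedChain ω₂ 0 0 γ).gibbsMeasure (N + 1) T)) ^ 2) = 0 := by
  simp only [harmonic_incoherentIntegrand_eq_zero hω hγ hT N, integral_zero, mul_zero]

end Harmonic

/-- **The conclusion of `IncoherentBounded` holds at the harmonic corner, with `B = 0`**: for the pinned
harmonic chain `pinnedChain ω₂ 0 0 γ` (`ω₂ > 0`, `γ ≥ 0`) and every `T > 0`, `|a_N| ≤ 0` for all `N`
(the item's body with `lam = β = 0` substituted). [folklore] -/
theorem incoherentBounded_conclusion_harmonic :
    ∀ ω₂ γ : ℝ, 0 < ω₂ → 0 ≤ γ → ∀ T : ℝ, 0 < T → ∃ B : ℝ, ∀ N : ℕ, |(N : ℝ) * (γ ^ 2 / T ^ 2) * ∫ t in Set.Ioi (0 : ℝ), ((∫ z, (z.2 0) ^ 2 * (∫ y, (y.2 (Fin.last N)) ^ 2 ∂((pinnedChain ω₂ 0 0 γ).transitionKernel (N + 1) T T t.toNNReal z)) ∂((pinnedChain ω₂ 0 0 γ).gibbsMeasure (N + 1) T)) - (∫ z, (z.2 0) ^ 2 ∂((pinnedChain ω₂ 0 0 γ).gibbsMeasure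 (N + 1) T)) * (∫ z, (∫ y, (y.2 (Fin.last N)) ^ 2 ∂((pinnedChain ω₂ 0 0 γ).transitionKernel (N + 1) T T t.toNNReal z)) ∂((pinnedChain ω₂ 0 0 γ).gibbsMeasure (N + 1) T)) - 2 * (∫ z, z.2 0 * (∫ y, y.2 (Fin.last N) ∂((pinnedChain ω₂ 0 0 γ).transitionKernel (N + 1) T T t.toNNReal z)) ∂((pinnedChain ω₂ 0 0 γ).gibbsMeasure (N + 1) T)) ^ 2)| ≤ B := by
  intro ω₂ γ hω hγ T hT
  refine ⟨0, fun N => ?_⟩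
  rw [harmonic_incoherentSeq_eq_zero hω hγ hT N, abs_zero]

/-- **The item relaxed to `0 ≤ lam`, `0 ≤ β` is NOT refuted at the harmonic corner** (contrast:
`HarmonicWick.crux_false_without_anharmonicity` for crux `IncoherentChannel`): the instance `lam = β = 0` of
the relaxed statement is true. [folklore] -/
theorem incoherentBounded_relaxed_harmonic_instance :
    ∀ ω₂ lam β γ : ℝ, 0 < ω₂ → lam = 0 → β = 0 → 0 < γ → ∀ T : ℝ, 0 < T → ∃ B : ℝ, ∀ N : ℕ, |(N : ℝ) * (γ ^ 2 / T ^ 2) * ∫ t in Set.Ioi (0 : ℝ), ((∫ z, (z.2 0) ^ 2 * (∫ y, (y.2 (Fin.last N)) ^ 2 ∂((pinnedChain ω₂ lam β γ).transitionKernel (N + 1) T T t.toNNReal z)) ∂((pinnedChain ω₂ lam β γ).gibbsMeasure (N + 1) T)) - (∫ z, (z.2 0) ^ 2 ∂((pinnedChain ω₂ lam β γ).gibbsMeasure (N + 1) T)) * (∫ z, (∫ y, (y.2 (Fin.last N)) ^ 2 ∂((pinnedChain ω₂ lam β γ).transitionKernel (N + 1) T T t.toNNReal z)) ∂((pinnedChain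 ω₂ lam β γ).gibbsMeasure (N + 1) T)) - 2 * (∫ z, z.2 0 * (∫ y, y.2 (Fin.last N) ∂((pinnedChain ω₂ lam β γ).transitionKernel (N + 1) T T t.toNNReal z)) ∂((pinnedChain ω₂ lam β γ).gibbsMeasure (N + 1) T)) ^ 2)| ≤ B := by
  intro ω₂ lam β γ hω hl hβ hγ T hT
  subst hl hβ
  exact incoherentBounded_conclusion_harmonic ω₂ γ hω hγ.le T hT

/-- **The harmonic corner separates the item from the bounded-response waypoint**: for `ω₂, γ > 0` the
incoherent sequence `a_N` of `pinnedChain ω₂ 0 0 γ` vanishes identically at every `T > 0`, while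
`HasBoundedResponse (pinnedChain ω₂ 0 0 γ)` is false (ballistic RLL flux: the finite-size conductance
`N·G_N = (coherent channel)` diverges linearly). So `IncoherentBounded`-type bounds do not control the
response without a bound on the coherent channel `2(γ²/T²) N ∫₀^∞ r_N²`.
[cite: BonettoLebowitzReyBellet2000, §6.2] -/
theorem harmonic_corner_separates {ω₂ γ : ℝ} (hω : 0 < ω₂) (hγ : 0 < γ) :
    (∀ T : ℝ, 0 < T → ∀ N : ℕ, (N : ℝ) * (γ ^ 2 / T ^ 2) * ∫ t in Set.Ioi (0 : ℝ), ((∫ z, (z.2 0) ^ 2 * (∫ y, (y.2 (Fin.last N)) ^ 2 ∂((pinnedChain ω₂ 0 0 γ).transitionKernel (N + 1) T T t.toNNReal z)) ∂((pinnedChain ω₂ 0 0 γ).gibbsMeasure (N + 1) T)) - (∫ z, (z.2 0) ^ 2 ∂((pinnedChain ω₂ 0 0 γ).gibbsMeasure (N + 1) T)) * (∫ z, (∫ y, (y.2 (Fin.last N)) ^ 2 ∂((pinnedChain ω₂ 0 0 γ).transitionKernel (N + 1) T T t.toNNReal z)) ∂((pinnedChain ω₂ 0 0 γ).gibbsMeasure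 (N + 1) T)) - 2 * (∫ z, z.2 0 * (∫ y, y.2 (Fin.last N) ∂((pinnedChain ω₂ 0 0 γ).transitionKernel (N + 1) T T t.toNNReal z)) ∂((pinnedChain ω₂ 0 0 γ).gibbsMeasure (N + 1) T)) ^ 2) = 0) ∧
      ¬ HasBoundedResponse (pinnedChain ω₂ 0 0 γ) :=
  ⟨fun _ hT N => harmonic_incoherentSeq_eq_zero hω hγ.le hT N,
    HarmonicChainBallisticFlux_holds.not_hasBoundedResponse hω hγ⟩

end Summit.AtomisticToContinuum.FouriersLaw.Theorems.IncoherentBounded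

end
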